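import Summits.KontsevichZagierPeriods.KontsevichZagierPeriods.Theorems.LiftingCriteriaDilationTransferOfCubeKernel
import Summits.KontsevichZagierPeriods.KontsevichZagierPeriods.Theorems.LiftingCriteriaDilationTransferPencilIntegrand

/-!
# `DilationTransfer` from the fibre kernel of the dilation pencil (crux stmt-KontsevichZagierPeriods-3572, RESHAPE 4, III)

Support file for crux `DilationTransfer`
(`Summit.KontsevichZagierPeriods.KontsevichZagierPeriods.Theses.LiftingCriteria.DilationTransfer`,
route `LiftingCriteria`, line `birth`): the composition of RESHAPE 4 of the line's skeleton.

* `dilationTransfer_of_pencilFibreKernel` — **Newton–Leibniz in the pencil parameter.** The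
  rescaled pencil integrand `P(x,s) = m₀ + Σ mᵢ gᵢ(ϖ₀s·πᵢx) − (ϖ₀s − ϖ₀)(μ₀(ϖ₀s) + Σ μⱼ(ϖ₀s) Gⱼ(ϖ₀s·π'ⱼx))`
  is Nash near `[0,1]^{N+1}` (toolkit file `…PencilIntegrand.lean`), satisfies `P(x,1) = f₀(x)`
  and — because the functional relation also holds at `ϖ = 0` — `P(x,0) = 0` identically. One
  cubical Stokes move (`KZ.cubicalStokesGens`, Kontsevich–Zagier's rule (3) along the last
  coordinate, primitive `P`) gives `[[0,1]^{N+1}, ∂_s P] ≡ [[0,1]^N, f₀ ∘ π]`, so the cube kernel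
  of `dilationTransfer_of_pencilCubeKernel` (file `…OfCubeKernel.lean`) follows from the FIBRE
  KERNEL statement: every cube representation of a last-coordinate derivative `P'` of `P` — all of
  whose fibre integrals `∫_{[0,1]^N} P'(x,s) dx = d/ds (relation at ϖ₀s) = 0` vanish — is a relation.
  That statement is the line's single registered stub after reshape 4 (`stub_pencilFibreKernel`):
  the relative Kontsevich–Zagier property of the pencil, summit-implied (Fubini + kernel
  conjecture), Ayoub's relative theorem at the motivic level, free of any Stokes normal form — and
  trivially true for the permutation data `gᵢ ∘ σ` that the tame normal form could not digest.

## References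
* M. Kontsevich, D. Zagier, *Periods* (2001), §1.2 (rule (3)).
* J. Ayoub, *Une version relative de la conjecture des périodes de Kontsevich–Zagier*, Ann. of
  Math. 181 (2015), Thm. 1.2 (relative version), Rem. 1.2.
-/

noncomputable section

open scoped BigOperators
open MeasureTheory Set Filter
open Literature.NumberTheory.Transcendental
open Literature.ModelTheory.ExponentialFields (IsSemialgebraic)
open Summit.KontsevichZagierPeriods.InverseLandau.TateFamilyKernel (exists_isTameCube_face)
open Summit.KontsevichZagierPeriods.KontsevichZagierPeriods.Theses.LiftingCriteria (DilationTransfer)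

namespace Summit.KontsevichZagierPeriods.LiftingCriteria.DilationTransfer

/-! ### The transfer: the crux from the fibre kernel of the pencil -/

/-- **`DilationTransfer` from the fibre kernel of the dilation pencil (Newton–Leibniz in the
parameter).** Suppose that for every datum of the crux and every functional-relation witness, on
any common cube `[0,1]^N` (`nᵢ, dⱼ ≤ N`), every cube representation `[[0,1]^{N+1}, P']` of a
last-coordinate derivative `P'` of the rescaled pencil integrand
`P(x,s) = m₀ + Σ mᵢ gᵢ(ϖ₀s·πᵢx) − (ϖ₀s − ϖ₀)(μ₀(ϖ₀s) + Σ μⱼ(ϖ₀s) Gⱼ(ϖ₀s·π'ⱼx))` is a relation (the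
FIBRE KERNEL of the pencil: all fibre integrals `∫_{[0,1]^N} P'(x,s)dx` vanish). Then the crux holds:
`P` is Nash near `[0,1]^{N+1}` (`pencil_analyticAt`, `pencil_isSemialgebraicFunOn`), `P(x,1) = f₀(x)`
(`pencil_snoc_one`) and `P(x,0) = 0` (`pencil_snoc_zero`, the relation at `ϖ = 0`), so one cubical
Stokes move along the last coordinate (`KZ.mem_cubicalStokesGens`, primitive `P`) gives
`[[0,1]^{N+1}, ∂_s P] ≡ [[0,1]^N, f₀ ∘ π]`, and `dilationTransfer_of_pencilCubeKernel` concludes.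
[cite: KontsevichZagier2001, §1.2 rule (3)] [cite: Ayoub2015, Thm. 1.2 and Rem. 1.2] -/
theorem dilationTransfer_of_pencilFibreKernel :
    (∀ (S : ℕ) (n : Fin S → ℕ) (g : (i : Fin S) → (Fin (n i) → ℝ) → ℝ) (U : (i : Fin S) → Set (Fin (n i) → ℝ)), (∀ i, IsOpen (U i) ∧ Set.pi Set.univ (fun _ : Fin (n i) => Set.Icc (0:ℝ) 1) ⊆ (U i) ∧ Literature.NumberTheory.Transcendental.IsSemialgebraicFunOn ℚ (U i) (g i) ∧ AnalyticOnNhd ℝ (g i) (U i)) → ∀ (m : Fin S → ℤ) (m₀ : ℤ) (ϖ₀ : ℚ), 0 < ϖ₀ → ϖ₀ ≤ 1 → ∀ (T : ℕ) (d : Fin T → ℕ) (G : (j : Fin T) → (Fin (d j) → ℝ) → ℝ) (V : (j : Fin T) → Set (Fin (d j) → ℝ)) (μ : Fin T → Polynomial ℝ) (μ₀ : Polynomial ℝ), (∀ j, IsOpen (V j) ∧ Set.pi Set.univ (fun _ : Fin (d j) => Set.Icc (0:ℝ) 1) ⊆ (V j) ∧ Literature.NumberTheory.Transcendental.IsSemialgebraicFunOn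 ℚ (V j) (G j) ∧ AnalyticOnNhd ℝ (G j) (V j)) → (∀ j k, IsAlgebraic ℚ ((μ j).coeff k)) → (∀ k, IsAlgebraic ℚ (μ₀.coeff k)) → (∀ ϖ ∈ Set.Icc (0:ℝ) 1, (m₀ : ℝ) + ∑ i, (m i : ℝ) * (∫ z in Set.pi Set.univ (fun _ : Fin (n i) => Set.Icc (0:ℝ) 1), g i (ϖ • z)) = (ϖ - (ϖ₀ : ℝ)) * (μ₀.eval ϖ + ∑ j, (μ j).eval ϖ * (∫ z in Set.pi Set.univ (fun _ : Fin (d j) => Set.Icc (0:ℝ) 1), G j (ϖ • z)))) → ∀ (N : ℕ) (hn : ∀ i, n i ≤ N) (hd : ∀ j, d j ≤ N) (P' : (Fin (N + 1) → ℝ) → ℝ), (∀ x ∈ Literature.NumberTheory.Transcendental.KZ.cube N, ∀ t ∈ Set.Icc (0:ℝ) 1, HasDerivAt (fun s : ℝ => (fun w : Fin (N + 1) → ℝ => (m₀ : ℝ) + ∑ i, (m i : ℝ) * g i (((ϖ₀ : ℝ) * w (Fin.last N)) • (fun l : Fin (n i) => w (Fin.castSucc (Fin.castLE (hn i) l))))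 - ((ϖ₀ : ℝ) * w (Fin.last N) - (ϖ₀ : ℝ)) * (μ₀.eval ((ϖ₀ : ℝ) * w (Fin.last N)) + ∑ j, (μ j).eval ((ϖ₀ : ℝ) * w (Fin.last N)) * G j (((ϖ₀ : ℝ) * w (Fin.last N)) • (fun l : Fin (d j) => w (Fin.castSucc (Fin.castLE (hd j) l)))))) (Fin.snoc x s)) (P' (Fin.snoc x t)) t) → ∀ (B : Literature.NumberTheory.Transcendental.KZ.IntegralRep (N + 1)), B.domain = Literature.NumberTheory.Transcendental.KZ.cube (N + 1) → (∀ w ∈ Literature.NumberTheory.Transcendental.KZ.cube (N + 1), B.integrand w = P' w) → Literature.NumberTheory.Transcendental.KZ.of B ∈ Literature.NumberTheory.Transcendental.KZ.relations) → Summit.KontsevichZagierPeriods.KontsevichZagierPeriods.Theses.LiftingCriteria.DilationTransfer := by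
  intro hF
  refine dilationTransfer_of_pencilCubeKernel fun S n g U hg m m₀ ϖ₀ hϖ0 hϖ1 hfun => ?_
  obtain ⟨T, d, G, V, μ, μ₀, hG, hμ, hμ₀, hrel⟩ := hfun
  have hϖ0' : (0 : ℝ) ≤ (ϖ₀ : ℝ) := by exact_mod_cast hϖ0.le
  have hϖ1' : (ϖ₀ : ℝ) ≤ 1 := by exact_mod_cast hϖ1
  -- a common cube `[0,1]^N` for all integrands
  set N : ℕ := Finset.univ.sup n ⊔ Finset.univ.sup d with hN
  have hn : ∀ i, n i ≤ N := fun i => (Finset.le_sup (Finset.mem_univ i)).trans le_sup_left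
  have hd : ∀ j, d j ≤ N := fun j => (Finset.le_sup (Finset.mem_univ j)).trans le_sup_right
  refine ⟨N, hn, fun A hAd hAi => ?_⟩
  -- the rescaled pencil integrand `P` and its natural neighbourhood `W`
  obtain ⟨P, hP⟩ : ∃ P : (Fin (N + 1) → ℝ) → ℝ, ∀ w, P w = (m₀ : ℝ) + ∑ i, (m i : ℝ) *
      g i (((ϖ₀ : ℝ) * w (Fin.last N)) • (fun l : Fin (n i) => w (Fin.castSucc (Fin.castLE (hn i) l)))) -
      ((ϖ₀ : ℝ) * w (Fin.last N) - (ϖ₀ : ℝ)) * (μ₀.eval ((ϖ₀ : ℝ) * w (Fin.last N)) +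
      ∑ j, (μ j).eval ((ϖ₀ : ℝ) * w (Fin.last N)) *
        G j (((ϖ₀ : ℝ) * w (Fin.last N)) • (fun l : Fin (d j) => w (Fin.castSucc (Fin.castLE (hd j) l))))) :=
    ⟨_, fun w => rfl⟩
  set W : Set (Fin (N + 1) → ℝ) := {w : Fin (N + 1) → ℝ |
      (∀ i, ((ϖ₀ : ℝ) * w (Fin.last N)) • (fun l : Fin (n i) => w (Fin.castSucc (Fin.castLE (hn i) l))) ∈ U i) ∧
      ∀ j, ((ϖ₀ : ℝ) * w (Fin.last N)) • (fun l : Fin (d j) => w (Fin.castSucc (Fin.castLE (hd j) l))) ∈ V j}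
    with hW
  have hWo : IsOpen W := isOpen_pencilNhd (fun i => (hg i).1) (fun j => (hG j).1) (ϖ₀ : ℝ) hn hd
  have hcW : KZ.cube (N + 1) ⊆ W :=
    cube_subset_pencilNhd (fun i => (hg i).2.1) (fun j => (hG j).2.1) hϖ0' hϖ1' hn hd
  have hPa : AnalyticOnNhd ℝ P W := fun w hw =>
    pencil_analyticAt (fun i => (hg i).2.2.2) (fun j => (hG j).2.2.2) hn hd hP hw.1 hw.2
  have hPs : IsSemialgebraicFunOn ℚ W P :=
    pencil_isSemialgebraicFunOn (fun i => (hg i).2.2.1) (fun j => (hG j).2.2.1) hμ hμ₀ hn hd hP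
  have hPa' : AnalyticOnNhd ℝ P (KZ.cube (N + 1)) := fun w hw => hPa w (hcW hw)
  have hPs' : IsSemialgebraicFunOn ℚ (KZ.cube (N + 1)) P := hPs.mono hcW KZ.isSemialgebraic_cube
  -- the derivative along the last coordinate, a tame integrand
  obtain ⟨P', hP'⟩ : ∃ P' : (Fin (N + 1) → ℝ) → ℝ, ∀ w, P' w = fderiv ℝ P w (Pi.single (Fin.last N) 1) :=
    ⟨_, fun w => rfl⟩
  have hP'a : AnalyticOnNhd ℝ P' (KZ.cube (N + 1)) := by
    intro w hw
    rw [show P' = _ from funext hP']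
    exact analyticAt_fderiv_apply (hPa' w hw) _
  have hP's : IsSemialgebraicFunOn ℚ (KZ.cube (N + 1)) P' := by
    rw [show P' = _ from funext hP']
    exact (IsSemialgebraicFunOn.fderiv_apply_single hWo hPs
      (fun x hx => (hPa x hx).differentiableAt) (Fin.last N)).mono hcW KZ.isSemialgebraic_cube
  have hder : ∀ x ∈ KZ.cube N, ∀ t ∈ Set.Icc (0:ℝ) 1,
      HasDerivAt (fun s : ℝ => P (Fin.snoc x s)) (P' (Fin.snoc x t)) t := by
    intro x hx t ht
    have hxt : (Fin.snoc x t : Fin (N + 1) → ℝ) ∈ KZ.cube (N + 1) := KZ.snoc_mem_cube_iff.2 ⟨hx, ht⟩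
    have hdf : HasFDerivAt P (fderiv ℝ P (Fin.snoc x t)) (Fin.snoc x t) :=
      (hPa' _ hxt).differentiableAt.hasFDerivAt
    have e : (fun s : ℝ => P (Fin.snoc x s)) = P ∘ Function.update (Fin.snoc x t) (Fin.last N) := by
      funext s
      simp [Fin.update_snoc_last]
    rw [e, hP']
    exact HasFDerivAt.comp_hasDerivAt_of_eq t hdf (hasDerivAt_update _ (Fin.last N) t)
      (by simp [Fin.update_snoc_last])
  -- the tame representations `B = [[0,1]^{N+1}, P']` and `A₁ = [[0,1]^N, P(·,1)]`
  obtain ⟨B, hBt, hBi⟩ : ∃ ρ : KZ.IntegralRep (N + 1), ρ.IsTameCube ∧ ρ.integrand = P' :=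
    ⟨KZ.IntegralRep.tameCube _ hP'a hP's, KZ.IntegralRep.isTameCube_tameCube _ _ _, rfl⟩
  have h1 : ((1 : ℚ) : ℝ) ∈ Set.Icc (0 : ℝ) 1 := by norm_num
  obtain ⟨A₁, hA₁t, hA₁i⟩ := exists_isTameCube_face hPa' hPs' (Fin.last N) h1
  have hA₁i' : ∀ x, A₁.integrand x = P (Fin.snoc x 1) := fun x => by
    rw [hA₁i]
    simp [Fin.insertNth_last']
  -- the relation at `ϖ = 0`: `P(·,0) ≡ 0`
  have hrel0 := hrel 0 ⟨le_rfl, zero_le_one⟩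
  have hP0 : ∀ x : Fin N → ℝ, P (Fin.snoc x 0) = 0 := fun x => by
    refine pencil_snoc_zero (g := g) (G := G) (m := m) (m₀ := m₀) (ϖ₀ := ϖ₀) (μ := μ) (μ₀ := μ₀) ?_ hn hd hP x
    simpa only [zero_sub] using hrel0
  -- one cubical Stokes move along the last coordinate: `[B] − [A₁]` is a relation
  have hSt : KZ.of B - KZ.of A₁ ∈ KZ.relations :=
    KZ.cubicalStokesGens_subset_relations (KZ.mem_cubicalStokesGens hBt hA₁t hPa' hPs'
      (fun x hx t ht => by rw [hBi]; exact hder x hx t ht)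
      (fun x _ => by rw [hA₁i' x, hP0 x, sub_zero]))
  -- the fibre kernel hypothesis: `[B]` is a relation
  have hB : KZ.of B ∈ KZ.relations :=
    hF S n g U hg m m₀ ϖ₀ hϖ0 hϖ1 T d G V μ μ₀ hG hμ hμ₀ hrel N hn hd P'
      (fun x hx t ht => by simpa only [hP] using hder x hx t ht) B hBt.domain_eq (fun w _ => by rw [hBi])
  -- congruence `[A] ≡ [A₁]` and conclusion
  have hAA₁ : KZ.of A - KZ.of A₁ ∈ KZ.relations := by
    refine KZ.of_sub_of_mem_relations_of_eqOn (by rw [hAd, hA₁t.domain_eq]) fun v hv => ?_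
    rw [hAd] at hv
    rw [hAi v hv, hA₁i' v, pencil_snoc_one hn hd hP v]
  have e : KZ.of A = (KZ.of A - KZ.of A₁) - (KZ.of B - KZ.of A₁) + KZ.of B := by abel
  rw [e]
  exact KZ.relations.add_mem (KZ.relations.sub_mem hAA₁ hSt) hB

end Summit.KontsevichZagierPeriods.LiftingCriteria.DilationTransfer
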